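import Literature.Geometry.Riemannian.DistSqBasepointDatum
import HarnessLib

/-!
# The one-ended directional datum of `d_t(x₀, ·)²` at `y ≠ x₀` with the exact first derivatives
# of the spatial barriers (Bamler 2020a, §9: `H_n`-centres stay near the basepoint)

R. Bamler, *Entropy and heat kernel bounds on a Ricci flow background*, arXiv:2008.07093 (2020a),
§9 (arXiv Lemma 37, the subsolution `e^{−Ct} φ(d_t(x₀, ·))`): the consumer composes `d_t(x₀, ·)²`
with a NONLINEAR monotone profile, so the chain rule in the barrier sense needs, besides the
second derivatives `bᵢ` of the directional upper barriers `Bᵢ` of `d²` at `y`, the exact FIRST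
derivatives `Bᵢ′(0)`: `2d` in the radial direction (the barrier `(T + σ)²`, `T = d_t(x₀, y)`) and
`0` in the transverse directions (the even barriers `T² + c σ²`); this reproduces `|∇d| = 1` of the
smooth computation. We re-export the datum of `distSq_basepoint_directional_datum` with this
information:

* `end_distSq_barriers_linear_deriv` — `end_distSq_barriers_linear` plus a distinguished index
  `i₀` with `B′_{i₀}(0) = 2T` and `Bᵢ′(0) = 0` for `i ≠ i₀`;
* `distSq_basepoint_directional_datum_deriv` — `distSq_basepoint_directional_datum` plus
  `B′_{i₀}(0) = 2 d_t(x₀, y)` and `Bᵢ′(0) = 0` for `i ≠ i₀`.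

Everything is proved; no definitions, no named facts.

## References

* R. H. Bamler, *Entropy and heat kernel bounds on a Ricci flow background*, arXiv:2008.07093
  (2020), §9 (arXiv Lemma 37). [Bamler2020Entropy]
* J. M. Lee, *Introduction to Riemannian Manifolds* (2018), Thm. 10.22 (second variation),
  Thm. 11.15 (Laplacian comparison). [LeeRiemannianManifolds2018]
-/
noncomputable section

open Bundle Set Function Filter MeasureTheory intervalIntegral
open scoped Manifold ContDiff Topology ENNReal NNReal Real

namespace Literature.Geometry.Riemannian

open Lorentzian Lorentzian.PseudoRiemannianMetric

section FarEnd

variable {E : Type*} [NormedAddCommGroup E] [NormedSpace ℝ E] [FiniteDimensional ℝ E]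
  [CompleteSpace E] {M : Type*} [TopologicalSpace M] [ChartedSpace E M] [IsManifold 𝓘(ℝ, E) ∞ M]
  [T2Space M]
  (g : PseudoRiemannianMetric 𝓘(ℝ, E) ∞ E (TangentSpace 𝓘(ℝ, E) : M → Type _)) [g.HasLeviCivita]
  [CovariantDerivative.ContMDiffCovariantDerivative g.leviCivita 1]
  [CovariantDerivative.ContMDiffCovariantDerivative g.leviCivita ∞]

/-- **Spatial directional barriers for `d(p, ·)²` at the far end `y₀ = exp_p(Tu)` of a unit speed
geodesic, linear weight, with first derivatives** (complete Riemannian manifold, `T > 0`,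
`ε₁ > 0`): a `g`-orthonormal frame `e` at `y₀` indexed by `Fin (dim M)`, polynomial upper barriers
`Bᵢ(σ) ≥ d(p, exp_{y₀}(σ eᵢ))²` for `σ` near `0` with `Bᵢ(0) = T²`, derivatives `Bᵢ′` and second
derivatives `bᵢ` at `0`, a radial index `i₀` with `B′_{i₀}(0) = 2T` (the barrier `(T + σ)²`) and
`Bᵢ′(0) = 0` for `i ≠ i₀` (the barriers `T² + (2Tqₒ + ε)σ²`), and
`Σᵢ bᵢ ≤ 2 dim M − 2T ∫₀ᵀ (s/T)² Ric(γ̇, γ̇) ds + ε₁`.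
[cite: LeeRiemannianManifolds2018, Thm. 11.15 (proof)] -/
theorem end_distSq_barriers_linear_deriv (hg : g.IsRiemannian)
    (hc : IsGeodesicallyComplete g.leviCivita)
    (p : M) (u : TangentSpace 𝓘(ℝ, E) p) (hu : g.val p u u = 1) {T : ℝ} (hT : 0 < T)
    {ε₁ : ℝ} (hε₁ : 0 < ε₁) :
    ∃ (e : Fin (Module.finrank ℝ E) → TangentSpace 𝓘(ℝ, E) (expMap g.leviCivita p (T • u)))
      (B B' : Fin (Module.finrank ℝ E) → ℝ → ℝ) (b : Fin (Module.finrank ℝ E) → ℝ)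
      (i₀ : Fin (Module.finrank ℝ E)),
      (∀ i j, g.val (expMap g.leviCivita p (T • u)) (e i) (e j) = if i = j then 1 else 0) ∧
      (∀ i, (∀ᶠ σ in 𝓝 (0 : ℝ), HasDerivAt (B i) (B' i σ) σ) ∧ HasDerivAt (B' i) (b i) 0 ∧
        B i 0 = T ^ 2 ∧
        ∀ᶠ σ in 𝓝 (0 : ℝ), (g.edist hg p
          (expMap g.leviCivita (expMap g.leviCivita p (T • u)) (σ • e i))).toReal ^ 2 ≤ B i σ) ∧
      B' i₀ 0 = 2 * T ∧ (∀ i, i ≠ i₀ → B' i 0 = 0) ∧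
      ∑ i, b i ≤ 2 * (Module.finrank ℝ E : ℝ) -
        2 * T * (∫ s in (0 : ℝ)..T, (s / T) ^ 2 *
            g.leviCivita.ricci (expMap g.leviCivita p (s • u))
              (velocity 𝓘(ℝ, E) (fun t ↦ expMap g.leviCivita p (t • u)) s)
              (velocity 𝓘(ℝ, E) (fun t ↦ expMap g.leviCivita p (t • u)) s)) + ε₁ := by
  classical
  obtain ⟨k, f, Q, hcard, hon, -, hrad, hbar, hQ⟩ := far_end_linear_datum g hg hc p u hu hT
  -- sizes
  have hk : (k : ℝ) = (Module.finrank ℝ E : ℝ) - 1 := by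
    have : Fintype.card (Option (Fin k)) = k + 1 := by simp
    rw [this] at hcard
    have : ((k + 1 : ℕ) : ℝ) = (Module.finrank ℝ E : ℝ) := by exact_mod_cast hcard
    push_cast at this; linarith
  -- the inner slack
  set ε : ℝ := ε₁ / (2 * ((k : ℝ) + 1) * (T ^ 2 + 1)) with hε_def
  have hε : 0 < ε := by positivity
  -- reindexing `Fin (dim M) ≃ Option (Fin k)`
  have hcardF : Fintype.card (Fin (Module.finrank ℝ E)) = Fintype.card (Option (Fin k)) := by
    rw [Fintype.card_fin, hcard]
  set ι : Fin (Module.finrank ℝ E) ≃ Option (Fin k) := Fintype.equivOfCardEq hcardF with hι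
  -- the barriers per direction `o`
  set q : Option (Fin k) → ℝ := fun o ↦ (Q o + ε * T) / 2 with hq
  set Bq : Option (Fin k) → ℝ → ℝ := fun o σ ↦
    if o = none then (T + σ) ^ 2 else T ^ 2 + (2 * T * q o + ε) * σ ^ 2 with hBq
  set Bq' : Option (Fin k) → ℝ → ℝ := fun o σ ↦
    if o = none then 2 * (T + σ) else 2 * (2 * T * q o + ε) * σ with hBq'
  set bq : Option (Fin k) → ℝ := fun o ↦ if o = none then 2 else 2 * (2 * T * q o + ε) with hbq
  have hBd : ∀ o σ, HasDerivAt (Bq o) (Bq' o σ) σ := by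
    intro o σ
    by_cases ho : o = none
    · have h1 : HasDerivAt (fun x : ℝ ↦ (T + x) ^ 2) (2 * (T + σ)) σ :=
        ((hasDerivAt_pow 2 (T + σ)).comp σ ((hasDerivAt_id' σ).const_add T)).congr_deriv (by ring)
      have e1 : Bq o = fun x : ℝ ↦ (T + x) ^ 2 := by funext x; simp [hBq, ho]
      have e2 : Bq' o σ = 2 * (T + σ) := by simp [hBq', ho]
      rw [e1, e2]; exact h1
    · have h1 : HasDerivAt (fun x : ℝ ↦ T ^ 2 + (2 * T * q o + ε) * x ^ 2)
          (2 * (2 * T * q o + ε) * σ) σ :=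
        (((hasDerivAt_pow 2 σ).const_mul (2 * T * q o + ε)).const_add (T ^ 2)).congr_deriv (by ring)
      have e1 : Bq o = fun x : ℝ ↦ T ^ 2 + (2 * T * q o + ε) * x ^ 2 := by funext x; simp [hBq, ho]
      have e2 : Bq' o σ = 2 * (2 * T * q o + ε) * σ := by simp [hBq', ho]
      rw [e1, e2]; exact h1
  have hB'd : ∀ o, HasDerivAt (Bq' o) (bq o) 0 := by
    intro o
    by_cases ho : o = none
    · have h1 : HasDerivAt (fun x : ℝ ↦ 2 * (T + x)) 2 0 :=
        (((hasDerivAt_id' (0 : ℝ)).const_add T).const_mul 2).congr_deriv (by ring)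
      have e1 : Bq' o = fun x : ℝ ↦ 2 * (T + x) := by funext x; simp [hBq', ho]
      have e2 : bq o = 2 := by simp [hbq, ho]
      rw [e1, e2]; exact h1
    · have h1 : HasDerivAt (fun x : ℝ ↦ 2 * (2 * T * q o + ε) * x) (2 * (2 * T * q o + ε)) 0 :=
        ((hasDerivAt_id' (0 : ℝ)).const_mul (2 * (2 * T * q o + ε))).congr_deriv (by ring)
      have e1 : Bq' o = fun x : ℝ ↦ 2 * (2 * T * q o + ε) * x := by funext x; simp [hBq', ho]
      have e2 : bq o = 2 * (2 * T * q o + ε) := by simp [hbq, ho]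
      rw [e1, e2]; exact h1
  have hB0 : ∀ o, Bq o 0 = T ^ 2 := by
    intro o; by_cases ho : o = none <;> simp [hBq, ho]
  -- the first derivatives at `0`
  have hB'0 : ∀ o, Bq' o 0 = if o = none then 2 * T else 0 := by
    intro o; by_cases ho : o = none <;> simp [hBq', ho]
  -- domination
  have hdom : ∀ o, ∀ᶠ σ in 𝓝 (0 : ℝ), (g.edist hg p
      (expMap g.leviCivita (expMap g.leviCivita p (T • u)) (σ • f o))).toReal ^ 2 ≤ Bq o σ := by
    intro o
    by_cases ho : o = none
    · subst ho
      filter_upwards [Ioo_mem_nhds (show -T < 0 by linarith) hT] with σ hσ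
      simp only [hBq, if_true]
      exact pow_le_pow_left₀ ENNReal.toReal_nonneg (hrad σ hσ) 2
    · filter_upwards [hbar o ε hε, eventually_sq_add_le T (q o) hε] with σ h1 h2
      simp only [ho, if_false, add_zero] at h1
      simp only [hBq, ho, if_false]
      have h0 : 0 ≤ (g.edist hg p (expMap g.leviCivita (expMap g.leviCivita p (T • u)) (σ • f o))).toReal :=
        ENNReal.toReal_nonneg
      have h3 : (g.edist hg p (expMap g.leviCivita (expMap g.leviCivita p (T • u)) (σ • f o))).toReal ^ 2 ≤
          (T + q o * σ ^ 2) ^ 2 := pow_le_pow_left₀ h0 (by simpa [hq] using h1) 2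
      exact h3.trans h2
  -- the sum of the second derivatives
  have hsumb : ∑ o, bq o = 2 + 2 * T * ((∑ o, Q o) - Q none) + (k : ℝ) * (2 * ε * T ^ 2 + 2 * ε) := by
    rw [Fintype.sum_option, Fintype.sum_option]
    simp only [hbq, if_true, Option.some_ne_none, if_false, hq]
    rw [show ∑ x : Fin k, 2 * (2 * T * ((Q (some x) + ε * T) / 2) + ε) =
        ∑ x : Fin k, (2 * T * Q (some x) + (2 * ε * T ^ 2 + 2 * ε)) from
      Finset.sum_congr rfl fun x _ ↦ by ring, Finset.sum_add_distrib, Finset.sum_const,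
      Finset.card_univ, Fintype.card_fin, nsmul_eq_mul, ← Finset.mul_sum]
    ring
  have hslack : (k : ℝ) * (2 * ε * T ^ 2 + 2 * ε) ≤ ε₁ := by
    have hk0 : 0 ≤ (k : ℝ) := Nat.cast_nonneg k
    have e1 : (k : ℝ) * (2 * ε * T ^ 2 + 2 * ε) = ε₁ * ((k : ℝ) / ((k : ℝ) + 1)) := by
      rw [hε_def]; field_simp
    rw [e1]
    have h2 : (k : ℝ) / ((k : ℝ) + 1) ≤ 1 := by rw [div_le_one (by positivity)]; linarith
    nlinarith
  -- assembly
  refine ⟨fun i ↦ f (ι i), fun i ↦ Bq (ι i), fun i ↦ Bq' (ι i), fun i ↦ bq (ι i), ι.symm none,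
    fun i j ↦ ?_, fun i ↦ ⟨Eventually.of_forall fun σ ↦ hBd _ σ, hB'd _, hB0 _, hdom _⟩, ?_,
    fun i hi ↦ ?_, ?_⟩
  · simp only [hon, EmbeddingLike.apply_eq_iff_eq]
  · show Bq' (ι (ι.symm none)) 0 = 2 * T
    rw [Equiv.apply_symm_apply, hB'0, if_pos rfl]
  · show Bq' (ι i) 0 = 0
    have hne : ι i ≠ none := fun h0 ↦ hi (by rw [← h0, Equiv.symm_apply_apply])
    rw [hB'0, if_neg hne]
  · rw [Fintype.sum_equiv ι (fun i ↦ bq (ι i)) bq (fun i ↦ rfl), hsumb, hQ]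
    rw [hk] at hslack ⊢
    have e : 2 * T * (((Module.finrank ℝ E : ℝ) - 1) / T) = 2 * ((Module.finrank ℝ E : ℝ) - 1) := by
      field_simp
    linarith [e, hslack]

end FarEnd

section Datum

variable {m : ℕ} {M : Type*} [TopologicalSpace M] [ChartedSpace (EuclideanSpace ℝ (Fin m)) M]
  [IsManifold 𝓘(ℝ, EuclideanSpace ℝ (Fin m)) ∞ M] [T2Space M] [CompactSpace M] [ConnectedSpace M]
  {h : ℝ → PseudoRiemannianMetric 𝓘(ℝ, EuclideanSpace ℝ (Fin m)) ∞ (EuclideanSpace ℝ (Fin m))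
    (TangentSpace 𝓘(ℝ, EuclideanSpace ℝ (Fin m)) : M → Type _)}
  [∀ r, (h r).HasLeviCivita]
  {cov : ℝ → CovariantDerivative 𝓘(ℝ, EuclideanSpace ℝ (Fin m)) (EuclideanSpace ℝ (Fin m))
    (TangentSpace 𝓘(ℝ, EuclideanSpace ℝ (Fin m)) : M → Type _)}

/-- **The one-ended directional datum of `d_t(x₀, ·)²` at `y ≠ x₀` under `|Ric| ≤ K` on the ball
`{d_t(x₀, ·) ≤ d_t(x₀, y)}`, with the exact first derivatives of the spatial barriers** (compact
Ricci flow, `t ∈ S` not the initial time, `η > 0`): an `h(t)`-orthonormal frame at `y` headed by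
the direction `i₀` of a minimising unit speed `h(t)`-geodesic `γ` from `x₀` to `y` of length
`T = d_t(x₀, y)`; the polynomial upper barriers of `end_distSq_barriers_linear_deriv` (so that
`Σᵢ bᵢ ≤ 2m + KT² + η`, `B′_{i₀}(0) = 2T`, `Bᵢ′(0) = 0` for `i ≠ i₀`); the linear left time
barrier `T² + p(t′ − t)` of slope `p ≥ −2KT² − η` (`IsRicciFlow.edist_toReal_sq_le_taylor_left`).
[cite: Bamler2020Entropy, §9, proof of arXiv Lem. 37] -/
theorem distSq_basepoint_directional_datum_deriv (hh : IsContMDiffFamilyOn ∞ h univ)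
    (hR : ∀ r, (h r).IsRiemannian) {S : Set ℝ} (hS : S.OrdConnected) (hflow : IsRicciFlow h cov S)
    {x₀ y : M} (hne : x₀ ≠ y) {t : ℝ} (ht : t ∈ S) (hleft : ∃ s ∈ S, s < t)
    {K : ℝ} (hK : 0 ≤ K)
    (hRic : ∀ z : M, (h t).edist (hR t) x₀ z ≤ (h t).edist (hR t) x₀ y →
      ∀ v : TangentSpace 𝓘(ℝ, EuclideanSpace ℝ (Fin m)) z,
        |(cov t).ricci z v v| ≤ K * (h t).val z v v)
    {η : ℝ} (hη : 0 < η) :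
    ∃ (ey : Fin (Module.finrank ℝ (EuclideanSpace ℝ (Fin m))) →
        TangentSpace 𝓘(ℝ, EuclideanSpace ℝ (Fin m)) y)
      (By By' : Fin (Module.finrank ℝ (EuclideanSpace ℝ (Fin m))) → ℝ → ℝ)
      (by_ : Fin (Module.finrank ℝ (EuclideanSpace ℝ (Fin m))) → ℝ) (Bt : ℝ → ℝ) (p : ℝ)
      (i₀ : Fin (Module.finrank ℝ (EuclideanSpace ℝ (Fin m)))),
      (∀ i j, (h t).val y (ey i) (ey j) = if i = j then 1 else 0) ∧
      (∀ i, (∀ᶠ σ in 𝓝 (0 : ℝ), HasDerivAt (By i) (By' i σ) σ) ∧ HasDerivAt (By' i) (by_ i) 0 ∧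
        By i 0 = ((h t).edist (hR t) x₀ y).toReal ^ 2 ∧
        ∀ᶠ σ in 𝓝 (0 : ℝ),
          ((h t).edist (hR t) x₀ (expMap (h t).leviCivita y (σ • ey i))).toReal ^ 2 ≤ By i σ) ∧
      By' i₀ 0 = 2 * ((h t).edist (hR t) x₀ y).toReal ∧ (∀ i, i ≠ i₀ → By' i 0 = 0) ∧
      (HasDerivWithinAt Bt p (Iic t) t ∧ Bt t = ((h t).edist (hR t) x₀ y).toReal ^ 2 ∧
        ∀ᶠ t' in 𝓝[<] t, ((h t').edist (hR t') x₀ y).toReal ^ 2 ≤ Bt t') ∧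
      ∑ i, by_ i ≤ 2 * m + K * ((h t).edist (hR t) x₀ y).toReal ^ 2 + η ∧
      -(2 * K * ((h t).edist (hR t) x₀ y).toReal ^ 2) - η ≤ p := by
  classical
  set g := h t with hg_def
  haveI : Fact ((1 : ℕ∞ω) ≤ (∞ : ℕ∞ω)) := ⟨by exact_mod_cast le_top⟩
  have h2 : (2 : ℕ∞ω) ≤ (∞ : ℕ∞ω) := WithTop.coe_le_coe.mpr le_top
  haveI : CovariantDerivative.ContMDiffCovariantDerivative g.leviCivita 1 :=
    contMDiffCovariantDerivative_leviCivita_of_two_le g h2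
  haveI : CovariantDerivative.ContMDiffCovariantDerivative g.leviCivita ((⊤ : ℕ∞) : ℕ∞ω) :=
    contMDiffCovariantDerivative_leviCivita_infty g le_rfl
  have hc : IsGeodesicallyComplete g.leviCivita := isGeodesicallyComplete_of_compactSpace g h2 (hR t)
  have hg : g.IsRiemannian := hR t
  -- a minimizing unit speed geodesic from `x₀` to `y`, `T = d_t(x₀, y) > 0`
  obtain ⟨u, T, hTpos, hu, hxTu, hT⟩ := exists_unit_minimizing g hg hc hne
  obtain ⟨hγs, hγ0, hspeed⟩ := contMDiff_and_unit_speed_expMap_smul g hc x₀ u hu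
  rw [zero_smul] at hγ0
  set γ : ℝ → M := fun s ↦ expMap g.leviCivita x₀ (s • u) with hγ_def
  have hγ0' : γ 0 = x₀ := by
    show expMap g.leviCivita x₀ ((0 : ℝ) • u) = x₀; rw [zero_smul]; exact hγ0
  have hγT : γ T = y := hxTu
  have hT2 : (g.edist hg x₀ y).toReal ^ 2 = T ^ 2 := by rw [hT]
  -- the slack
  have hε : 0 < η / 4 := by positivity
  -- the spatial barriers at `y` (linear weight, with first derivatives)
  obtain ⟨ey, By, By', by_, i₀, hony, hBy, hBy'₀, hBy'ne, hsumy⟩ :=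
    end_distSq_barriers_linear_deriv g hg hc x₀ u hu hTpos hε
  rw [hxTu] at hony hBy
  -- the time barrier (flow equation)
  have hspeed' : ∀ s ∈ Icc (0 : ℝ) T, (h t).val (γ s)
      (velocity 𝓘(ℝ, EuclideanSpace ℝ (Fin m)) γ s) (velocity 𝓘(ℝ, EuclideanSpace ℝ (Fin m)) γ s) = 1 :=
    fun s _ ↦ hspeed s
  have hdistγ : ((h t).edist (hR t) (γ 0) (γ T)).toReal = T := by rw [hγ0', hγT]; exact hT
  have htime := hflow.edist_toReal_sq_le_taylor_left hh hR hS ht hleft hγs hTpos hspeed' hdistγ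
    (η / 4) hε
  rw [hγ0', hγT] at htime
  -- the Ricci integrand along `γ`: `(cov t).ricci = g.ricci`
  set Rfun : ℝ → ℝ := fun s ↦ g.leviCivita.ricci (γ s) (velocity 𝓘(ℝ, EuclideanSpace ℝ (Fin m)) γ s)
    (velocity 𝓘(ℝ, EuclideanSpace ℝ (Fin m)) γ s) with hRfun
  have hcovR : ∀ s, (cov t).ricci (γ s) (velocity 𝓘(ℝ, EuclideanSpace ℝ (Fin m)) γ s)
      (velocity 𝓘(ℝ, EuclideanSpace ℝ (Fin m)) γ s) = Rfun s := by
    intro s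
    have := IsLeviCivita.ricci_eq_ricci (hflow.isLeviCivita t ht) h2 (γ s)
    simp only [hRfun, this]
    rfl
  have hIcov : ∫ s in (0 : ℝ)..T, (cov t).ricci (γ s) (velocity 𝓘(ℝ, EuclideanSpace ℝ (Fin m)) γ s)
      (velocity 𝓘(ℝ, EuclideanSpace ℝ (Fin m)) γ s) = ∫ s in (0 : ℝ)..T, Rfun s :=
    intervalIntegral.integral_congr fun s _ ↦ hcovR s
  rw [hIcov] at htime
  have hRc : Continuous Rfun := by
    have hTl := contMDiff_lift_velocity_of_contMDiff (I := 𝓘(ℝ, EuclideanSpace ℝ (Fin m))) hγs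
    exact (show ContMDiff 𝓘(ℝ, ℝ) 𝓘(ℝ, ℝ) ∞ _ from
      fun s ↦ contMDiffAt_ricci_apply_along g (hTl s) (hTl s)).continuous
  -- `|Ric(γ̇, γ̇)| ≤ K` on `[0, T]`: `γ` stays in the ball `{d(x₀, ·) ≤ d(x₀, y)}`
  have hTtop : g.edist hg x₀ y ≠ ⊤ := by
    intro htop
    rw [htop, ENNReal.toReal_top] at hT
    exact hTpos.ne' hT.symm
  have hRK : ∀ s ∈ Icc (0 : ℝ) T, |Rfun s| ≤ K := by
    intro s hs
    obtain ⟨hfin, hle⟩ := edist_toReal_le_of_unit_speed g hg hγs hs.1 hspeed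
    rw [hγ0'] at hfin hle
    have hball : g.edist hg x₀ (γ s) ≤ g.edist hg x₀ y := by
      rw [← ENNReal.ofReal_toReal hfin, ← ENNReal.ofReal_toReal hTtop, hT]
      exact ENNReal.ofReal_le_ofReal (hle.trans hs.2)
    have h1 := hRic (γ s) hball (velocity 𝓘(ℝ, EuclideanSpace ℝ (Fin m)) γ s)
    rw [hcovR s, hspeed s, mul_one] at h1
    exact h1
  -- the two Ricci integrals
  have hI1 : 2 * T * (∫ s in (0 : ℝ)..T, Rfun s) ≤ 2 * T * (K * T) := by
    refine mul_le_mul_of_nonneg_left ?_ (by positivity)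
    have h1 : ∫ s in (0 : ℝ)..T, Rfun s ≤ ∫ _ in (0 : ℝ)..T, K :=
      intervalIntegral.integral_mono_on hTpos.le (hRc.intervalIntegrable _ _)
        (continuous_const.intervalIntegrable _ _) (fun s hs ↦ (abs_le.1 (hRK s hs)).2)
    rwa [intervalIntegral.integral_const, smul_eq_mul, sub_zero, mul_comm] at h1
  have hI2 : -(2 * T * ∫ s in (0 : ℝ)..T, (s / T) ^ 2 * Rfun s) ≤ 2 * T * (K * T / 3) := by
    have hwc : Continuous fun s : ℝ ↦ (s / T) ^ 2 := (continuous_id.div_const T).pow 2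
    have h1 : ∫ s in (0 : ℝ)..T, (s / T) ^ 2 * (-K) ≤ ∫ s in (0 : ℝ)..T, (s / T) ^ 2 * Rfun s :=
      intervalIntegral.integral_mono_on hTpos.le
        ((hwc.mul continuous_const).intervalIntegrable _ _) ((hwc.mul hRc).intervalIntegrable _ _)
        (fun s hs ↦ mul_le_mul_of_nonneg_left (abs_le.1 (hRK s hs)).1 (sq_nonneg (s / T)))
    have hsq : ∫ s in (0 : ℝ)..T, (s / T) ^ 2 * (-K) = -(K * T / 3) := by
      have e1 : (fun s : ℝ ↦ (s / T) ^ 2 * (-K)) = fun s ↦ (-K / T ^ 2) * s ^ 2 := by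
        funext s
        field_simp
      rw [e1, intervalIntegral.integral_const_mul, integral_pow]
      norm_num
      field_simp
    rw [hsq] at h1
    nlinarith [h1, hTpos]
  -- the linear time barrier
  set p : ℝ := -(2 * T * ∫ s in (0 : ℝ)..T, Rfun s) - η / 4 with hp
  set Bt : ℝ → ℝ := fun t' ↦ (g.edist hg x₀ y).toReal ^ 2 + p * (t' - t) with hBt
  have hBtd : HasDerivWithinAt Bt p (Iic t) t := by
    have := (((hasDerivAt_id' t).sub_const t).const_mul p).const_add ((g.edist hg x₀ y).toReal ^ 2)
    exact (this.congr_deriv (by ring)).hasDerivWithinAt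
  -- assembly
  refine ⟨ey, By, By', by_, Bt, p, i₀, hony, fun i ↦ ?_, by rw [hBy'₀, hT], hBy'ne,
    ⟨hBtd, by simp only [hBt, sub_self, mul_zero, add_zero]; rfl, ?_⟩, ?_, ?_⟩
  · obtain ⟨hd1, hd2, hB0, hdom⟩ := hBy i
    exact ⟨hd1, hd2, by rw [hB0]; exact hT2.symm, hdom⟩
  · filter_upwards [htime] with t' ht'
    show _ ≤ (g.edist hg x₀ y).toReal ^ 2 + p * (t' - t)
    convert ht' using 2
  · -- the spatial inequality
    have hfr : (Module.finrank ℝ (EuclideanSpace ℝ (Fin m)) : ℝ) = m := by simp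
    rw [hfr] at hsumy
    change ∑ i, by_ i ≤ 2 * (m : ℝ) - 2 * T * (∫ s in (0 : ℝ)..T, (s / T) ^ 2 * Rfun s) + η / 4
      at hsumy
    rw [hT2]
    have hKT : 0 ≤ K * T ^ 2 := by positivity
    nlinarith [hsumy, hI2, hKT, hη]
  · -- the time inequality
    rw [hT2]
    have hKT : 0 ≤ K * T ^ 2 := by positivity
    nlinarith [hI1, hKT, hη]

end Datum

end Literature.Geometry.Riemannian

end
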